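import Summits.BirchSwinnertonDyer.BirchSwinnertonDyer.Theorems.UniversalToricDescentSigmaCongruenceAtThreeIffInvariantPair
import Literature.NumberTheory.EllipticCurves.Hsieh2014.AnticyclotomicPAdicLFunctionAnyLevel
import HarnessLib

/-!
# Node `TwinForcedConstant` (crux-ideate g19 on A = `SigmaCongruenceAtThree`, stmt-BirchSwinnertonDyer-27120)

Memo `NodeTwinForcedConstant.md` (same directory).  D-0171 node: a compiling Cruxes file, no `sorry`; every piece
tagged; the compositions conclude A BY NAME (`sigmaCongruenceAtThree_of_canonicalRoot`,
`sigmaCongruenceAtThree_of_integralRootFunctional`).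

## 0. What this node adds to the g18 hand-off (`NodeTransferWitnessAudit.md` §4, §8)

g18 re-tagged the pool's transfer statements F/F♭/F𝔪 as presentations of «A ∧ Sq» (free-functional lemma) and
asked g19 to TYPE the pinned replacement A♮ (`CanonicalRootCongruenceAtThree`) and to draft KI♯ (the Hsieh–Katz
integral CM functional) whose «load-bearing clause is that the valuation of the wild Waldspurger constant `c_g` is
`g`-independent» (§4 KI♯, §8 T-g18-2).  This node does the typing and removes that clause:

* **N1 — TWIN FORCING (PROVED here as pure `R₀⟦T⟧`-algebra, §1 `twin_forcing`).**  In the two frame identities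
  `C a·(u·𝓛Π_E) = C b·Y²` (wild) and `C a′·(u′·𝓛′Π_{E′}) = C b′·Y′²` (twin), once the TWIN constant is canonical
  (`‖a′‖ = ‖b′‖` — in print the tame BDP/Waldspurger constant, [BDP13, Thm. 5.13 + (3.44)], [Hsieh2014, Thm. A:
  `‖ι⁻¹C‖ = 1`]) and the roots are congruent (`Y ≡ Y′ mod 𝔪`, from the Hecke congruence H through ANY additive
  integral functional), `μ(𝓛′) = 0` (A's hypothesis (μ′)) FORCES `μ(Y′) = 0`, hence `μ(Y) = 0`, hence — comparing
  Gauss norms in (wild), `μ(𝓛) = 0` being Hsieh Thm. B — `‖a‖ = ‖b‖`: THE WILD CONSTANT IS FORCED TO BE CANONICAL.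
  Consequence: KI needs NO valuation clause on the wild side (KI♭ below = KI♯ minus that clause); the wild
  Waldspurger/Gross-period constant at additive level `27·M₀` never has to be computed or compared (this is the
  clause every pool memo since g11 (lever 9, «self-ratio») and g15 (I-g15-2 (ii)) flagged as the research risk of
  the CM-functional line).  Technique differentiation: the RS card's `TwinForcesWallConstant` (g11 §3, DEAD with
  B-g11-2) forced a COMMON level-index factor `ν` of the Petersson functional and died because `v₃(ν) ≥ 1` hits both
  evaluations; here the functional is the `p`-adic CM-evaluation `Θ` (tame level `M₀`, no level index at `3`), the
  twin evaluation is the TAME canonical one, and what is forced is the free constant of the WILD evaluation only.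
* **N2 — HSIEH PRINTS THE ROOT (typed §4).**  [Hsieh2014, Thm. A p. 712 / arXiv:1112.1580 Thm. 1] constructs
  `𝒫_Σ(π,λ) ∈ Λ` and `ℒ_p(π_K ⊗ χ) = [g]⁻¹·Tw(𝒫²)`; the tree's facts (`hsieh2014_exists_anticyclotomicPAdicLFunction`,
  `Hsieh2014.thmA_exists_isHsiehLFunction_unrPeriod_anyLevel`) type only `Q` with `IsHsiehLFunction … Q` and drop
  the squareness.  Since `Γ⁻` is pro-`3` (`g = h²`) and `Tw` is a ring automorphism, `Q = ([h]⁻¹·Tw 𝒫)²`: the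
  one-clause sharpening `HsiehRootFormAnyLevel` (§4: same binders, conclusion `IsHsiehLFunction … (P ^ 2)`) is
  weaker than print and implies the existing fact (`thmA_anyLevel_of_rootForm`, PROVED).  It makes g18's leaf
  `SqL_E` («the wild frame is const·unit·square», tagged IDEA-NEEDED there) a TYPER task (S), independent of N1.

## Pieces and tags (memo §4 has the table with evidence)

* §1 `norm_const_eq_of_C_mul_eq`, `exists_coeff_norm_eq_one_of_sq`, `exists_coeff_norm_eq_one_of_frame`,
  `frame_of_unit_gauge`, `twin_forcing` — PROVED · pure algebra · WEAKER than A (no arithmetic content).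
* §2 `IsMonomialUnit`, **A♮ `CanonicalRootCongruenceAtThree`** — STRONGER than F♭ (hence than A given Thm. B) ·
  TRANSFER · UNDECIDED · ATTACKABLE (port: KI♭ + H, §3); COSTUME: none (§2 docstring: the free-functional witness of
  g18 §1 does not produce it — the congruence is ON THE NOSE between roots pinned by monomial-gauged frames).
  `congruentSquareRootPair_of_canonicalRoot` (A♮ → F♭), `sigmaCongruenceAtThree_of_canonicalRoot` (Thm. B → A♮ → A,
  A BY NAME) — PROVED.
* §3 **KI♭ `IntegralRootFunctionalAtThree`** — named-fact-shaped (Hsieh §3–5 / Katz CM measure applied to the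
  `3`-depleted toric forms of `f_E`, `f_{E′}`; values-only shadow) · its functional-free shadow is «A♮-frames ∧ tame
  twin constant» (g18 §1 applies: `Θ` on two vectors is free) — filed as PRESENTATION + PROVENANCE, not as extra
  logical strength · ATTACKABLE (port; memo §3 lists the print inputs) · NO valuation clause (N1).
  H `HeckeCongruenceDepleted` (copied) — WEAKER · ATTACKABLE (M).  `canonicalRoot_of_integralRootFunctional`
  (KI♭ → H → A♮) and `sigmaCongruenceAtThree_of_integralRootFunctional` (Thm. B → H → KI♭ → A) — PROVED.
* §4 `HsiehRootFormAnyLevel` — named-fact-shaped sharpening (typer S) · `thmA_anyLevel_of_rootForm` PROVED.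
* Thm. B (`hB`) — print, Literature named fact [Hsieh2014, Thm. B].  Dead lines of the route (24208 kernel_rat RK-6
  v2, 24209, RK-7 v1) untouched; idea `rankin-selberg-linearity-transplant` stays DEAD (memo §5).
-/

set_option autoImplicit false
-- `…BirchSwinnertonDyer.BirchSwinnertonDyer.Cruxes…` is the problem's mandated namespace (D-0017).
set_option linter.dupNamespace false

noncomputable section

open scoped Classical

namespace Summit.BirchSwinnertonDyer.BirchSwinnertonDyer.Cruxes.SigmaCongruenceAtThree.TwinForcedConstant

open NumberField IsDedekindDomain
open Literature.NumberTheory.EllipticCurves Literature.NumberTheory.EllipticCurves.GreenbergVatsal2000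
  Summit.BirchSwinnertonDyer.Rank1Residual.X11b
  Summit.BirchSwinnertonDyer.BirchSwinnertonDyer.Theorems.UniversalToricDescentNormProfile
  Summit.BirchSwinnertonDyer.BirchSwinnertonDyer.Theorems.UniversalToricDescentAcEulerFactor
  Summit.BirchSwinnertonDyer.BirchSwinnertonDyer.Theorems
  Summit.BirchSwinnertonDyer.BirchSwinnertonDyer.Theses.UniversalToricDescent

/-! ### §0 Small helpers (copied from node `TransferWitnessAudit` §1; Cruxes modules are not importable) -/

/-- `‖3‖ < 1` in `ℂ₃`. [folklore] -/
theorem norm_three_lt_one : ‖((3 : ℕ) : ℂ_[3])‖ < 1 := by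
  haveI : Fact (Nat.Prime 3) := ⟨Nat.prime_three⟩
  have h : ‖((3 : ℕ) : ℂ_[3])‖ = ‖((3 : ℕ) : ℚ_[3])‖ := by
    rw [← map_natCast (algebraMap ℚ_[3] ℂ_[3]) 3, norm_algebraMap']
  rw [h]
  exact Padic.norm_p_lt_one

/-- The constant `3` of `R₀⟦T⟧` is `C 3`. [folklore] -/
theorem three_eq_C : (3 : UnrSeries 3) = PowerSeries.C (3 : unrIntegers 3) :=
  (map_ofNat (PowerSeries.C (R := unrIntegers 3)) 3).symm

/-- `‖3 · z‖ < 1` for `z ∈ R₀`. [folklore] -/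
theorem norm_three_mul_lt_one (z : unrIntegers 3) : ‖(((3 : unrIntegers 3) * z : unrIntegers 3) : ℂ_[3])‖ < 1 := by
  have h3 : ((3 : unrIntegers 3) : ℂ_[3]) = ((3 : ℕ) : ℂ_[3]) := by push_cast; rfl
  rw [Subring.coe_mul, norm_mul, h3]
  exact mul_lt_one_of_nonneg_of_lt_one_left (norm_nonneg _) norm_three_lt_one
    (Halves.norm_coe_unrIntegers_le_one 3 z)

/-- An additive `Θ` transports coordinatewise divisibility `3^k ∣ g − g′` to `3^k ∣ Θ g − Θ g′`. [folklore] -/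
theorem forall_exists_of_addMonoidHom (Θ : (ℕ → ℤ) →+ UnrSeries 3) (g g' : ℕ → ℤ) (k : ℕ)
    (h : ∀ n : ℕ, (3 : ℤ) ^ k ∣ g n - g' n) :
    ∃ Z : UnrSeries 3, Θ g - Θ g' = (3 : UnrSeries 3) ^ k * Z := by
  choose x hx using h
  refine ⟨Θ x, ?_⟩
  have hg : g = g' + ((3 : ℤ) ^ k) • x := by
    funext n
    simp only [Pi.add_apply, Pi.smul_apply, smul_eq_mul, ← hx n]
    ring
  rw [hg, map_add, map_zsmul, add_sub_cancel_left, zsmul_eq_mul]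
  push_cast
  rfl

/-- Two non-zero constant multiples of series with norm profiles `M, M′` are equal only if `M = M′` (copied from node
`TransferWitnessAudit` §3 = node `HeckeDualElement` §4). [cite: Washington1997, §7.1] -/
theorem profile_eq_of_C_mul_eq {X Y : UnrSeries 3} {a b : unrIntegers 3} {M M' : ℕ} (ha : a ≠ 0) (hb : b ≠ 0)
    (hX : (∀ i < M, ‖((PowerSeries.coeff i X : unrIntegers 3) : ℂ_[3])‖ < 1) ∧
      ‖((PowerSeries.coeff M X : unrIntegers 3) : ℂ_[3])‖ = 1)
    (hY : (∀ i < M', ‖((PowerSeries.coeff i Y : unrIntegers 3) : ℂ_[3])‖ < 1) ∧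
      ‖((PowerSeries.coeff M' Y : unrIntegers 3) : ℂ_[3])‖ = 1)
    (h : PowerSeries.C a * X = PowerSeries.C b * Y) : M = M' := by
  have key : ∀ i, ‖(a : ℂ_[3])‖ * ‖((PowerSeries.coeff i X : unrIntegers 3) : ℂ_[3])‖ =
      ‖(b : ℂ_[3])‖ * ‖((PowerSeries.coeff i Y : unrIntegers 3) : ℂ_[3])‖ := by
    intro i
    have hi := congrArg (PowerSeries.coeff i) h
    simp only [PowerSeries.coeff_C_mul] at hi
    have hi' := congrArg (fun z : unrIntegers 3 ↦ ‖(z : ℂ_[3])‖) hi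
    simpa only [Subring.coe_mul, norm_mul] using hi'
  have ha' : 0 < ‖(a : ℂ_[3])‖ := norm_pos_iff.mpr (by simpa using ha)
  have hb' : 0 < ‖(b : ℂ_[3])‖ := norm_pos_iff.mpr (by simpa using hb)
  rcases lt_trichotomy M M' with hlt | heq | hgt
  · exfalso
    have h1 := key M
    have h2 := key M'
    rw [hX.2, mul_one] at h1
    rw [hY.2, mul_one] at h2
    have hab : ‖(a : ℂ_[3])‖ < ‖(b : ℂ_[3])‖ := by
      rw [h1]; exact mul_lt_of_lt_one_right hb' (hY.1 M hlt)
    have hba : ‖(b : ℂ_[3])‖ ≤ ‖(a : ℂ_[3])‖ := by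
      rw [← h2]; exact mul_le_of_le_one_right ha'.le (norm_coeff_le_one X M')
    exact absurd hab (not_lt.mpr hba)
  · exact heq
  · exfalso
    have h1 := key M'
    have h2 := key M
    rw [hY.2, mul_one] at h1
    rw [hX.2, mul_one] at h2
    have hba : ‖(b : ℂ_[3])‖ < ‖(a : ℂ_[3])‖ := by
      rw [← h1]; exact mul_lt_of_lt_one_right ha' (hX.1 M' hgt)
    have hab : ‖(a : ℂ_[3])‖ ≤ ‖(b : ℂ_[3])‖ := by
      rw [h2]; exact mul_le_of_le_one_right hb'.le (norm_coeff_le_one Y M)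
    exact absurd hba (not_lt.mpr hab)

/-! ### §1 Twin forcing — the algebra (PROVED; pure `R₀⟦T⟧` ultrametric bookkeeping, no arithmetic input)

Profiles are spelled, as everywhere on the route, `(∀ i < n, ‖[T^i]X‖ < 1) ∧ ‖[T^n]X‖ = 1` («`μ(X) = 0, λ(X) = n`»). -/

/-- Constants of a frame identity between two `μ = 0` series have equal norm: `C a·X = C b·Y`, `X` of profile `M`,
`Y` of profile `M′`, `a, b ≠ 0` ⟹ `‖a‖ = ‖b‖` (and `M = M′`, `profile_eq_of_C_mul_eq`). [cite: Washington1997, §7.1] -/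
theorem norm_const_eq_of_C_mul_eq {X Y : UnrSeries 3} {a b : unrIntegers 3} {M M' : ℕ} (ha : a ≠ 0) (hb : b ≠ 0)
    (hX : (∀ i < M, ‖((PowerSeries.coeff i X : unrIntegers 3) : ℂ_[3])‖ < 1) ∧
      ‖((PowerSeries.coeff M X : unrIntegers 3) : ℂ_[3])‖ = 1)
    (hY : (∀ i < M', ‖((PowerSeries.coeff i Y : unrIntegers 3) : ℂ_[3])‖ < 1) ∧
      ‖((PowerSeries.coeff M' Y : unrIntegers 3) : ℂ_[3])‖ = 1)
    (h : PowerSeries.C a * X = PowerSeries.C b * Y) : ‖(a : ℂ_[3])‖ = ‖(b : ℂ_[3])‖ := by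
  have hMM' : M = M' := profile_eq_of_C_mul_eq ha hb hX hY h
  subst hMM'
  have hi := congrArg (PowerSeries.coeff M) h
  simp only [PowerSeries.coeff_C_mul] at hi
  have hi' := congrArg (fun z : unrIntegers 3 ↦ ‖(z : ℂ_[3])‖) hi
  simp only [Subring.coe_mul, norm_mul] at hi'
  rwa [hX.2, hY.2, mul_one, mul_one] at hi'

/-- If `Y²` has a coefficient of norm `1` then so has `Y` (contrapositive: all `‖[T^j]Y‖ < 1` ⟹ all `‖[T^i](Y·Y)‖ < 1`,
ultrametric). [folklore] -/
theorem exists_coeff_norm_eq_one_of_sq {Y : UnrSeries 3}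
    (h : ∃ i : ℕ, ‖((PowerSeries.coeff i (Y ^ 2) : unrIntegers 3) : ℂ_[3])‖ = 1) :
    ∃ i : ℕ, ‖((PowerSeries.coeff i Y : unrIntegers 3) : ℂ_[3])‖ = 1 := by
  by_contra hne
  push Not at hne
  have hlt : ∀ j : ℕ, ‖((PowerSeries.coeff j Y : unrIntegers 3) : ℂ_[3])‖ < 1 :=
    fun j ↦ lt_of_le_of_ne (norm_coeff_le_one Y j) (hne j)
  obtain ⟨i, hi⟩ := h
  have hlt2 := norm_coeff_mul_lt_one_of_lt Y (n := i + 1) (fun j _ ↦ hlt j) i (Nat.lt_succ_self i)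
  rw [← sq] at hlt2
  exact absurd hi (ne_of_lt hlt2)

/-- Undo a unit gauge: `C a·(u·X) = C b·Y²` with `u` a unit gives `C a·X = C b·(u⁻¹·Y²)`. [folklore] -/
theorem frame_of_unit_gauge {X Y u : UnrSeries 3} {a b : unrIntegers 3} (hu : IsUnit u)
    (h : PowerSeries.C a * (u * X) = PowerSeries.C b * Y ^ 2) :
    PowerSeries.C a * X = PowerSeries.C b * ((↑hu.unit⁻¹ : UnrSeries 3) * Y ^ 2) := by
  calc PowerSeries.C a * X = ((↑hu.unit⁻¹ : UnrSeries 3) * u) * (PowerSeries.C a * X) := by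
        rw [hu.val_inv_mul, one_mul]
    _ = (↑hu.unit⁻¹ : UnrSeries 3) * (PowerSeries.C a * (u * X)) := by ring
    _ = (↑hu.unit⁻¹ : UnrSeries 3) * (PowerSeries.C b * Y ^ 2) := by rw [h]
    _ = PowerSeries.C b * ((↑hu.unit⁻¹ : UnrSeries 3) * Y ^ 2) := by ring

/-- A CANONICAL frame pins `μ` of the root: `C a·(u·X) = C b·Y²` with `‖a‖ = ‖b‖ ≠ 0`, `u` a unit and `μ(X) = 0`
(profile `M`) ⟹ `Y` has a coefficient of norm `1` (`‖[T^M](Y²)‖ = 1`, then `exists_coeff_norm_eq_one_of_sq`).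
[folklore] -/
theorem exists_coeff_norm_eq_one_of_frame {X Y u : UnrSeries 3} {a b : unrIntegers 3} {M : ℕ} (ha : a ≠ 0)
    (hab : ‖(a : ℂ_[3])‖ = ‖(b : ℂ_[3])‖) (hu : IsUnit u)
    (hX : (∀ i < M, ‖((PowerSeries.coeff i X : unrIntegers 3) : ℂ_[3])‖ < 1) ∧
      ‖((PowerSeries.coeff M X : unrIntegers 3) : ℂ_[3])‖ = 1)
    (h : PowerSeries.C a * (u * X) = PowerSeries.C b * Y ^ 2) :
    ∃ i : ℕ, ‖((PowerSeries.coeff i Y : unrIntegers 3) : ℂ_[3])‖ = 1 := by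
  apply exists_coeff_norm_eq_one_of_sq
  refine ⟨M, ?_⟩
  have huX := normProfile_mul_of_isUnit hu hX
  have hi := congrArg (PowerSeries.coeff M) h
  simp only [PowerSeries.coeff_C_mul] at hi
  have hi' := congrArg (fun z : unrIntegers 3 ↦ ‖(z : ℂ_[3])‖) hi
  simp only [Subring.coe_mul, norm_mul] at hi'
  rw [huX.2, mul_one, hab] at hi'
  have hb' : 0 < ‖(b : ℂ_[3])‖ := by
    rw [← hab]; exact norm_pos_iff.mpr (by simpa using ha)
  have h1 : ‖(b : ℂ_[3])‖ * 1 = ‖(b : ℂ_[3])‖ *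
      ‖((PowerSeries.coeff M (Y ^ 2) : unrIntegers 3) : ℂ_[3])‖ := by rw [mul_one]; exact hi'
  exact (mul_left_cancel₀ hb'.ne' h1).symm

/-- **TWIN FORCING (N1).**  Two gauged frame identities `C a·(u·X) = C b·Y²`, `C a′·(u′·X′) = C b′·Y′²` over `R₀⟦T⟧`
with `μ(X) = μ(X′) = 0` (profiles `M, M′`), units `u, u′`, non-zero constants, the TWIN one canonical (`‖a′‖ = ‖b′‖`)
and congruent roots (`Y ≡ Y′` coefficientwise `mod 𝔪`) force the WILD constant to be canonical (`‖a‖ = ‖b‖`) and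
`μ(Y) = 0`.  (Print reading: `X = 𝓛·Π_E(e)`, `X′ = 𝓛′·Π_{E′}(e)`, `Y, Y′` the CM-functional values on the depleted
toric forms; the twin side is tame and its constant is BDP's/Hsieh's canonical unit.) [folklore] -/
theorem twin_forcing {X X' Y Y' u u' : UnrSeries 3} {a b a' b' : unrIntegers 3} {M M' : ℕ}
    (ha : a ≠ 0) (hb : b ≠ 0) (ha' : a' ≠ 0) (hab' : ‖(a' : ℂ_[3])‖ = ‖(b' : ℂ_[3])‖)
    (hu : IsUnit u) (hu' : IsUnit u')
    (hX : (∀ i < M, ‖((PowerSeries.coeff i X : unrIntegers 3) : ℂ_[3])‖ < 1) ∧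
      ‖((PowerSeries.coeff M X : unrIntegers 3) : ℂ_[3])‖ = 1)
    (hX' : (∀ i < M', ‖((PowerSeries.coeff i X' : unrIntegers 3) : ℂ_[3])‖ < 1) ∧
      ‖((PowerSeries.coeff M' X' : unrIntegers 3) : ℂ_[3])‖ = 1)
    (h : PowerSeries.C a * (u * X) = PowerSeries.C b * Y ^ 2)
    (h' : PowerSeries.C a' * (u' * X') = PowerSeries.C b' * Y' ^ 2)
    (hcongr : ∀ i : ℕ, ‖((PowerSeries.coeff i (Y - Y') : unrIntegers 3) : ℂ_[3])‖ < 1) :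
    ‖(a : ℂ_[3])‖ = ‖(b : ℂ_[3])‖ ∧ ∃ i : ℕ, ‖((PowerSeries.coeff i Y : unrIntegers 3) : ℂ_[3])‖ = 1 := by
  haveI : Fact (Nat.Prime 3) := ⟨Nat.prime_three⟩
  obtain ⟨f', hf'⟩ := UniversalToricDescentSelfMuZero.exists_normProfile_of_exists_coeff_norm_eq_one
    (exists_coeff_norm_eq_one_of_frame ha' hab' hu' hX' h')
  have hfY := normProfile_of_forall_norm_sub_lt hcongr hf'
  have hY2 := normProfile_mul hfY hfY
  rw [← sq] at hY2
  exact ⟨norm_const_eq_of_C_mul_eq ha hb (normProfile_mul_of_isUnit hu hX) hY2 h, f', hfY.2⟩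

/-! ### §2 A♮ `CanonicalRootCongruenceAtThree` (g18 §4 (A♮), TYPED), F♭ and H (copied), A♮ ⟹ F♭ ⟹ A BY NAME -/

/-- The MONOMIAL GAUGE group of `R₀⟦T⟧`: `u = c₀·(1+T)^α` with `c₀ ∈ R₀ˣ`, `α ∈ ℤ₃` — the only freedom between two
`R₀`-frames of one `p`-adic `L`-function (period scaling, [BDP13, Thm. 5.9], and change of topological generator,
`Γ⁻ ≅ ℤ₃`); `(1+T)^α = binomialSeries ℤ₃ α` pushed into `R₀⟦T⟧`.  Design note (memo §3): the gauge is carried on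
the FRAME side of A♮/KI♭ and never manipulated (no group law on binomial series is needed in the kernel); on paper a
monomial unit is a unit square (`3 ∤ 2`), so this is g18's «`Y ≡ c₀(1+T)^α·Y′`» with the relative gauge absorbed.
[cite: BDP2013, Thm. 5.9] [cite: Washington1997, §7.1] -/
def IsMonomialUnit (u : UnrSeries 3) : Prop :=
  ∃ (c₀ : unrIntegers 3) (α : ℤ_[3]), IsUnit c₀ ∧
    u = PowerSeries.C c₀ * PowerSeries.map (Halves.toUnr 3) (PowerSeries.binomialSeries ℤ_[3] α)

/-- **A♮ `CanonicalRootCongruenceAtThree`** (g18 memo §4, typed here; binders = A's, verbatim).  On A's data there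
are exponents `e_v ≠ 0` of valuation `c_v` and ROOTS `Y, Y′ ∈ R₀⟦T⟧` such that
(wild♮) `C a·(u·𝓛·Π_E(e)) = C b·Y²` with `u` a MONOMIAL unit gauge (so `Y` is THE root of the wild frame up to the
monomial torsor `±c(1+T)^β` — not a free square root dressed by an arbitrary unit `w` as in F♭);
(twin♮) the same for `𝓛′·Π_{E′}(e)`, `Y′`; (μ′) `μ(Y′) = 0`; and (congruence ON THE NOSE) `Y − Y′ ∈ 3·R₀⟦T⟧`.
Print reading: `Y = Θ(g_E)`, `Y′ = Θ(g_{E′})` for the integral CM functional `Θ` of §3 (Hsieh's `𝒫`-construction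
applied to the `3`-depleted toric newforms), congruent because `g_E ≡ g_{E′} (mod 3)` (H).
Tags: STRONGER than F♭ (`congruentSquareRootPair_of_canonicalRoot`) hence than A given Thm. B · TRANSFER ·
UNDECIDED · ATTACKABLE (port = KI♭ ∧ H, `canonicalRoot_of_integralRootFunctional`).  COSTUME check: A does not give
the frames (Sq_E is not a consequence of A), and g18's free-functional witness (§1 there) produces F/F♭/F𝔪 from
«A ∧ Sq» but NOT A♮ — rescaling free roots `Y ↦ sY` by unit square roots of the gauges destroys `Y − Y′ ∈ (3)`
unless `s ≡ s′`, which is exactly the canonical-normalisation content.  Degenerate-witness pass: `a = 0`/`Y = 0`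
excluded (`a ≠ 0`, `R₀⟦T⟧` a domain); `u` cannot absorb a non-monomial unit; the `3`-adic exponents `e` are pinned
by `valuation = c_v`.
[cite: Hsieh2014, Thm. A, Prop. 3.5, Thm. 3.9] [cite: BDP2013, Thm. 5.13, (3.44), Thm. 5.9] [cite: KrizLi2019, §3] -/
def CanonicalRootCongruenceAtThree : Prop :=
      ∀ (W : WeierstrassCurve ℚ) [W.IsElliptic] [W.IsGloballyMinimal] (W' : WeierstrassCurve ℚ) [W'.IsElliptic]
      [W'.IsGloballyMinimal] (N N' : ℕ) [NeZero N] [NeZero N'] (K : Type) [Field K] [NumberField K] (Dt :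
      Literature.NumberTheory.EllipticCurves.ModularForms.ModularParametrizationData W N) (Dt' :
      Literature.NumberTheory.EllipticCurves.ModularForms.ModularParametrizationData W' N'),
      Summit.BirchSwinnertonDyer.Rank1Residual.Additive.ClassO6 W 3 → W.HasSurjectiveModNGaloisRep 3 →
      W.analyticRank = 1 → W.conductorNorm ℤ = N → Summit.BirchSwinnertonDyer.Rank1Residual.O6.ModPCongruent W' W
      3 → ¬ Literature.NumberTheory.EllipticCurves.Rank1Residual.Addv W' 3 → W'.conductorNorm ℤ = N' →
      Literature.NumberTheory.EllipticCurves.IsImaginaryQuadratic K →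
      Literature.NumberTheory.EllipticCurves.SatisfiesHeegnerHypothesis N K →
      Literature.NumberTheory.EllipticCurves.SatisfiesHeegnerHypothesis N' K → ∀ (κ :
      Literature.NumberTheory.EllipticCurves.ZpExtension K 3), κ.IsAnticyclotomic → ∀ (γ :
      Field.absoluteGaloisGroup K) [Fact (κ.IsTopGenerator γ)] (𝔭 : IsDedekindDomain.HeightOneSpectrum
      (NumberField.RingOfIntegers K)), ((3 : ℕ) : NumberField.RingOfIntegers K) ∈ 𝔭.asIdeal →
      𝔭.asIdeal.ramificationIdx (NumberField.RingOfIntegers ℚ) = 1 → 𝔭.asIdeal.inertiaDeg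
      (NumberField.RingOfIntegers ℚ) = 1 → ∀ (𝔭' : IsDedekindDomain.HeightOneSpectrum (NumberField.RingOfIntegers
      K)), ((3 : ℕ) : NumberField.RingOfIntegers K) ∈ 𝔭'.asIdeal → 𝔭' ≠ 𝔭 → ∀ (ι' : PadicAlgCl 3 ≃+* ℂ),
      Summit.BirchSwinnertonDyer.BirchSwinnertonDyer.Theorems.SchneiderFree.BranchInducesPrime 3 ι' 𝔭 → ∀ (ΩK : ℂ)
      (Ωp : ℂ_[3]) (L : Literature.NumberTheory.EllipticCurves.UnrSeries 3), ΩK ≠ 0 → Ωp ≠ 0 →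
      Literature.NumberTheory.EllipticCurves.IsBDPLFunction ι' 𝔭 κ γ Dt.f ΩK Ωp L → ∀ (ΩK' : ℂ) (Ωp' : ℂ_[3]) (L'
      : Literature.NumberTheory.EllipticCurves.UnrSeries 3), ΩK' ≠ 0 → Ωp' ≠ 0 →
      Literature.NumberTheory.EllipticCurves.IsBDPLFunction ι' 𝔭 κ γ Dt'.f ΩK' Ωp' L' → (∃ i : ℕ,
      ‖((PowerSeries.coeff i L' : Literature.NumberTheory.EllipticCurves.unrIntegers 3) : ℂ_[3])‖ = 1) → ∀ (T :
      Finset (IsDedekindDomain.HeightOneSpectrum (NumberField.RingOfIntegers K))) (c :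
      IsDedekindDomain.HeightOneSpectrum (NumberField.RingOfIntegers K) → ℕ), (↑T = {v :
      IsDedekindDomain.HeightOneSpectrum (NumberField.RingOfIntegers K) | ((3 : ℕ) : NumberField.RingOfIntegers K)
      ∉ v.asIdeal ∧ (¬ (W.baseChange K).HasGoodReductionAt v ∨ ¬ (W'.baseChange K).HasGoodReductionAt v)}) → (∀ v
      ∈ T, (∃ d₀ : Literature.NumberTheory.EllipticCurves.GreenbergSelmer.decomp (K := K) v, (κ (d₀ :
      Field.absoluteGaloisGroup K)).toAdd = (3 : ℤ_[3]) ^ c v) ∧ (∀ d :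
      Literature.NumberTheory.EllipticCurves.GreenbergSelmer.decomp (K := K) v, (3 : ℤ_[3]) ^ c v ∣ (κ (d :
      Field.absoluteGaloisGroup K)).toAdd)) →
      ∃ (e : IsDedekindDomain.HeightOneSpectrum (NumberField.RingOfIntegers K) → ℤ_[3])
        (Y Y' : Literature.NumberTheory.EllipticCurves.UnrSeries 3),
        (∀ v ∈ T, e v ≠ 0 ∧ (e v).valuation = c v) ∧
        (∃ (a b : Literature.NumberTheory.EllipticCurves.unrIntegers 3)
            (u : Literature.NumberTheory.EllipticCurves.UnrSeries 3), a ≠ 0 ∧ b ≠ 0 ∧ IsUnit u ∧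
          IsMonomialUnit u ∧
          PowerSeries.C a * (u * (L * PowerSeries.map (Summit.BirchSwinnertonDyer.Rank1Residual.X11b.Halves.toUnr 3)
            (∏ v ∈ T, (Polynomial.aeval
              (PowerSeries.C ((Nat.card (IsLocalRing.ResidueField (v.adicCompletionIntegers K)) : ℤ_[3]).inv) *
                PowerSeries.binomialSeries ℤ_[3] (e v)) ((W.baseChange K).localPolynomialAt v) :
              Literature.NumberTheory.EllipticCurves.IwasawaAlgebra 3)))) =
          PowerSeries.C b * Y ^ 2) ∧
        (∃ (a' b' : Literature.NumberTheory.EllipticCurves.unrIntegers 3)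
            (u' : Literature.NumberTheory.EllipticCurves.UnrSeries 3), a' ≠ 0 ∧ b' ≠ 0 ∧ IsUnit u' ∧
          IsMonomialUnit u' ∧
          PowerSeries.C a' * (u' * (L' * PowerSeries.map (Summit.BirchSwinnertonDyer.Rank1Residual.X11b.Halves.toUnr 3)
            (∏ v ∈ T, (Polynomial.aeval
              (PowerSeries.C ((Nat.card (IsLocalRing.ResidueField (v.adicCompletionIntegers K)) : ℤ_[3]).inv) *
                PowerSeries.binomialSeries ℤ_[3] (e v)) ((W'.baseChange K).localPolynomialAt v) :
              Literature.NumberTheory.EllipticCurves.IwasawaAlgebra 3)))) =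
          PowerSeries.C b' * Y' ^ 2) ∧
        (∃ i : ℕ, ‖((PowerSeries.coeff i Y' :
          Literature.NumberTheory.EllipticCurves.unrIntegers 3) : ℂ_[3])‖ = 1) ∧
        ∃ Z : Literature.NumberTheory.EllipticCurves.UnrSeries 3,
          Y - Y' = (3 : Literature.NumberTheory.EllipticCurves.UnrSeries 3) * Z

/-- **F♭ `CongruentSquareRootPair`** — copied VERBATIM from node `TransferWitnessAudit` §3 (g18) = node
`HeckeDualElement` §2 (g9) (Cruxes modules are not built, so they cannot be imported).  Tag (g18 memo §3):
= «A ∧ Sq_E ∧ Sq_{E′}» (paper); kernel: F♭ ⟹ A given Thm. B (`sigmaCongruenceAtThree_of_congruentSquareRootPair`).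
[cite: Hsieh2014, Thm. A, Prop. 3.5] [cite: KrizLi2019, Def. 3.1–3.2] -/
def CongruentSquareRootPair : Prop :=
      ∀ (W : WeierstrassCurve ℚ) [W.IsElliptic] [W.IsGloballyMinimal] (W' : WeierstrassCurve ℚ) [W'.IsElliptic]
      [W'.IsGloballyMinimal] (N N' : ℕ) [NeZero N] [NeZero N'] (K : Type) [Field K] [NumberField K] (Dt :
      Literature.NumberTheory.EllipticCurves.ModularForms.ModularParametrizationData W N) (Dt' :
      Literature.NumberTheory.EllipticCurves.ModularForms.ModularParametrizationData W' N'),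
      Summit.BirchSwinnertonDyer.Rank1Residual.Additive.ClassO6 W 3 → W.HasSurjectiveModNGaloisRep 3 →
      W.analyticRank = 1 → W.conductorNorm ℤ = N → Summit.BirchSwinnertonDyer.Rank1Residual.O6.ModPCongruent W' W
      3 → ¬ Literature.NumberTheory.EllipticCurves.Rank1Residual.Addv W' 3 → W'.conductorNorm ℤ = N' →
      Literature.NumberTheory.EllipticCurves.IsImaginaryQuadratic K →
      Literature.NumberTheory.EllipticCurves.SatisfiesHeegnerHypothesis N K →
      Literature.NumberTheory.EllipticCurves.SatisfiesHeegnerHypothesis N' K → ∀ (κ :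
      Literature.NumberTheory.EllipticCurves.ZpExtension K 3), κ.IsAnticyclotomic → ∀ (γ :
      Field.absoluteGaloisGroup K) [Fact (κ.IsTopGenerator γ)] (𝔭 : IsDedekindDomain.HeightOneSpectrum
      (NumberField.RingOfIntegers K)), ((3 : ℕ) : NumberField.RingOfIntegers K) ∈ 𝔭.asIdeal →
      𝔭.asIdeal.ramificationIdx (NumberField.RingOfIntegers ℚ) = 1 → 𝔭.asIdeal.inertiaDeg
      (NumberField.RingOfIntegers ℚ) = 1 → ∀ (𝔭' : IsDedekindDomain.HeightOneSpectrum (NumberField.RingOfIntegers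
      K)), ((3 : ℕ) : NumberField.RingOfIntegers K) ∈ 𝔭'.asIdeal → 𝔭' ≠ 𝔭 → ∀ (ι' : PadicAlgCl 3 ≃+* ℂ),
      Summit.BirchSwinnertonDyer.BirchSwinnertonDyer.Theorems.SchneiderFree.BranchInducesPrime 3 ι' 𝔭 → ∀ (ΩK : ℂ)
      (Ωp : ℂ_[3]) (L : Literature.NumberTheory.EllipticCurves.UnrSeries 3), ΩK ≠ 0 → Ωp ≠ 0 →
      Literature.NumberTheory.EllipticCurves.IsBDPLFunction ι' 𝔭 κ γ Dt.f ΩK Ωp L → ∀ (ΩK' : ℂ) (Ωp' : ℂ_[3]) (L'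
      : Literature.NumberTheory.EllipticCurves.UnrSeries 3), ΩK' ≠ 0 → Ωp' ≠ 0 →
      Literature.NumberTheory.EllipticCurves.IsBDPLFunction ι' 𝔭 κ γ Dt'.f ΩK' Ωp' L' → (∃ i : ℕ,
      ‖((PowerSeries.coeff i L' : Literature.NumberTheory.EllipticCurves.unrIntegers 3) : ℂ_[3])‖ = 1) → ∀ (T :
      Finset (IsDedekindDomain.HeightOneSpectrum (NumberField.RingOfIntegers K))) (c :
      IsDedekindDomain.HeightOneSpectrum (NumberField.RingOfIntegers K) → ℕ), (↑T = {v :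
      IsDedekindDomain.HeightOneSpectrum (NumberField.RingOfIntegers K) | ((3 : ℕ) : NumberField.RingOfIntegers K)
      ∉ v.asIdeal ∧ (¬ (W.baseChange K).HasGoodReductionAt v ∨ ¬ (W'.baseChange K).HasGoodReductionAt v)}) → (∀ v
      ∈ T, (∃ d₀ : Literature.NumberTheory.EllipticCurves.GreenbergSelmer.decomp (K := K) v, (κ (d₀ :
      Field.absoluteGaloisGroup K)).toAdd = (3 : ℤ_[3]) ^ c v) ∧ (∀ d :
      Literature.NumberTheory.EllipticCurves.GreenbergSelmer.decomp (K := K) v, (3 : ℤ_[3]) ^ c v ∣ (κ (d :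
      Field.absoluteGaloisGroup K)).toAdd)) →
      ∃ (e : IsDedekindDomain.HeightOneSpectrum (NumberField.RingOfIntegers K) → ℤ_[3])
        (Y Y' : Literature.NumberTheory.EllipticCurves.UnrSeries 3),
        (∀ v ∈ T, e v ≠ 0 ∧ (e v).valuation = c v) ∧
        (∀ i : ℕ, ‖((PowerSeries.coeff i (Y - Y') :
          Literature.NumberTheory.EllipticCurves.unrIntegers 3) : ℂ_[3])‖ < 1) ∧
        (∃ (a b : Literature.NumberTheory.EllipticCurves.unrIntegers 3)
            (w : Literature.NumberTheory.EllipticCurves.UnrSeries 3), a ≠ 0 ∧ b ≠ 0 ∧ IsUnit w ∧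
          PowerSeries.C a * (L * PowerSeries.map (Summit.BirchSwinnertonDyer.Rank1Residual.X11b.Halves.toUnr 3)
            (∏ v ∈ T, (Polynomial.aeval
              (PowerSeries.C ((Nat.card (IsLocalRing.ResidueField (v.adicCompletionIntegers K)) : ℤ_[3]).inv) *
                PowerSeries.binomialSeries ℤ_[3] (e v)) ((W.baseChange K).localPolynomialAt v) :
              Literature.NumberTheory.EllipticCurves.IwasawaAlgebra 3))) =
          PowerSeries.C b * (w * Y ^ 2)) ∧
        (∃ (a' b' : Literature.NumberTheory.EllipticCurves.unrIntegers 3)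
            (w' : Literature.NumberTheory.EllipticCurves.UnrSeries 3), a' ≠ 0 ∧ b' ≠ 0 ∧ IsUnit w' ∧
          PowerSeries.C a' * (L' * PowerSeries.map (Summit.BirchSwinnertonDyer.Rank1Residual.X11b.Halves.toUnr 3)
            (∏ v ∈ T, (Polynomial.aeval
              (PowerSeries.C ((Nat.card (IsLocalRing.ResidueField (v.adicCompletionIntegers K)) : ℤ_[3]).inv) *
                PowerSeries.binomialSeries ℤ_[3] (e v)) ((W'.baseChange K).localPolynomialAt v) :
              Literature.NumberTheory.EllipticCurves.IwasawaAlgebra 3))) =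
          PowerSeries.C b' * (w' * Y' ^ 2)) ∧
        (∃ i : ℕ, ‖((PowerSeries.coeff i Y' :
          Literature.NumberTheory.EllipticCurves.unrIntegers 3) : ℂ_[3])‖ = 1)

/-- **H `HeckeCongruenceDepleted`** — the line's stub `stub_heckeCongruence`, copied VERBATIM (g18 §3): for
`3`-congruent `E′ ∼ E`, `a_n(E) ≡ a_n(E′) (mod 3)` for every `n` prime to `3NN′`.  Tag: WEAKER than A · ATTACKABLE (M).
[cite: SilvermanAEC2009, C.21 Remark 21.3] [cite: DiamondShurman2005, Prop. 5.8.5] -/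
def HeckeCongruenceDepleted : Prop :=
      ∀ (W : WeierstrassCurve ℚ) [W.IsElliptic] [W.IsGloballyMinimal] (W' : WeierstrassCurve ℚ) [W'.IsElliptic]
      [W'.IsGloballyMinimal] (N N' : ℕ), W.conductorNorm ℤ = N → W'.conductorNorm ℤ = N' →
      Summit.BirchSwinnertonDyer.Rank1Residual.O6.ModPCongruent W' W 3 →
      ∀ n : ℕ, Nat.Coprime n (3 * (N * N')) → (3 : ℤ) ∣ W.LFunction n - W'.LFunction n

/-- **A♮ ⟹ F♭ (PROVED).**  Undo the unit gauges (`w := u⁻¹`, `frame_of_unit_gauge`) and weaken `Y − Y′ = 3·Z` to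
`‖[T^i](Y − Y′)‖ ≤ ‖3‖ < 1`. [folklore] -/
theorem congruentSquareRootPair_of_canonicalRoot (h : CanonicalRootCongruenceAtThree) : CongruentSquareRootPair := by
  intro W _ _ W' _ _ N N' _ _ K _ _ Dt Dt' hO6 hsurj hrk hN hmod haddv hN' hK hH hH' κ hκ γ _ 𝔭 h𝔭 hram
      hdeg 𝔭' h𝔭' hne ι' hι ΩK Ωp L hΩK hΩp hL ΩK' Ωp' L' hΩK' hΩp' hL' hi' T c hT hc
  obtain ⟨e, Y, Y', he, ⟨a, b, u, ha, hb, hu, -, hEq⟩, ⟨a', b', u', ha', hb', hu', -, hEq'⟩, hμ', Z, hZ⟩ :=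
    h W W' N N' K Dt Dt' hO6 hsurj hrk hN hmod haddv hN' hK hH hH' κ hκ γ 𝔭 h𝔭 hram hdeg 𝔭' h𝔭' hne ι' hι ΩK Ωp
      L hΩK hΩp hL ΩK' Ωp' L' hΩK' hΩp' hL' hi' T c hT hc
  refine ⟨e, Y, Y', he, fun i ↦ ?_, ⟨a, b, (↑hu.unit⁻¹ : UnrSeries 3), ha, hb, Units.isUnit _,
      frame_of_unit_gauge hu hEq⟩,
    ⟨a', b', (↑hu'.unit⁻¹ : UnrSeries 3), ha', hb', Units.isUnit _, frame_of_unit_gauge hu' hEq'⟩, hμ'⟩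
  rw [hZ, three_eq_C, PowerSeries.coeff_C_mul]
  exact norm_three_mul_lt_one _

/-- **F♭ ⟹ A given Thm. B (PROVED; A concluded BY NAME)** — copied verbatim from node `TransferWitnessAudit` §3 (g18)
= node `HeckeDualElement` §4 (g9): rewrite A as the λ-identity; `𝓛·Π_E(e)` has profile `m + D`, `𝓛′·Π_{E′}(e)`
profile `m′ + D′`; `Y′` has a profile `f′` (μ′), `Y ≡ Y′` so `Y` has profile `f′`; `w·Y²`, `w′·Y′²` have profile
`2f′`; (wild)/(twin) force `m + D = 2f′ = m′ + D′`. -/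
theorem sigmaCongruenceAtThree_of_congruentSquareRootPair
    (hB : Literature.NumberTheory.EllipticCurves.Hsieh2014.thmB_exists_isHsiehLFunction_coeff_norm_eq_one_unrPeriod_anyLevel)
    (hF : CongruentSquareRootPair) : SigmaCongruenceAtThree := by
  haveI : Fact (Nat.Prime 3) := ⟨Nat.prime_three⟩
  rw [UniversalToricDescentSigmaCongruenceInvariantPair.sigmaCongruenceAtThree_iff_lambdaIdentity_of_thmB hB]
  intro W _ _ W' _ _ N N' _ _ K _ _ Dt Dt' hO6 hsurj hrk hN hmod haddv hN' hK hH hH' κ hκ γ _ 𝔭 h𝔭 hram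
      hdeg 𝔭' h𝔭' hne ι' hι ΩK Ωp L hΩK hΩp hL ΩK' Ωp' L' hΩK' hΩp' hL' hi' T c hT hc m m' hm hm'
  obtain ⟨e, Y, Y', he, hcongr, ⟨a, b, w, ha, hb, hw, hEq⟩, ⟨a', b', w', ha', hb', hw', hEq'⟩, hi0'⟩ :=
    hF W W' N N' K Dt Dt' hO6 hsurj hrk hN hmod haddv hN' hK hH hH' κ hκ γ 𝔭 h𝔭 hram hdeg 𝔭' h𝔭' hne ι' hι ΩK Ωp L
      hΩK hΩp hL ΩK' Ωp' L' hΩK' hΩp' hL' hi' T c hT hc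
  have hT3 := UniversalToricDescentSigmaCongruenceInvariantPair.not_mem_of_coe_eq hT
  obtain ⟨-, hordE⟩ := order_map_toZMod_prod_aeval_localPolynomialAt (W.baseChange K) T hT3 e
    (fun v hv ↦ (he v hv).1)
  obtain ⟨-, hordE'⟩ := order_map_toZMod_prod_aeval_localPolynomialAt (W'.baseChange K) T hT3 e
    (fun v hv ↦ (he v hv).1)
  have hX := normProfile_mul hm (normProfile_map_toUnr_of_order_eq _ hordE)
  have hX' := normProfile_mul hm' (normProfile_map_toUnr_of_order_eq _ hordE')
  obtain ⟨f', hF'⟩ := UniversalToricDescentSelfMuZero.exists_normProfile_of_exists_coeff_norm_eq_one hi0'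
  have hFY := normProfile_of_forall_norm_sub_lt hcongr hF'
  have hF2 := normProfile_mul hFY hFY
  have hF2' := normProfile_mul hF' hF'
  rw [← sq] at hF2 hF2'
  have hwF2 := normProfile_mul_of_isUnit hw hF2
  have hwF2' := normProfile_mul_of_isUnit hw' hF2'
  have h1 := profile_eq_of_C_mul_eq ha hb hX hwF2 hEq
  have h2 := profile_eq_of_C_mul_eq ha' hb' hX' hwF2' hEq'
  have key : ∀ E : WeierstrassCurve K,
      ∑ v ∈ T, (eulerFactorModP E 3 v).rootMultiplicity
            (((Nat.card (IsLocalRing.ResidueField (v.adicCompletionIntegers K)) : ℕ) : ZMod 3)⁻¹) *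
          3 ^ (e v).valuation =
        ∑ v ∈ T, 3 ^ c v * (eulerFactorModP E 3 v).rootMultiplicity
            (((Nat.card (IsLocalRing.ResidueField (v.adicCompletionIntegers K)) : ℕ) : ZMod 3)⁻¹) :=
    fun E ↦ Finset.sum_congr rfl fun v hv ↦ by rw [(he v hv).2, mul_comm]
  rw [← key, ← key]
  omega

/-- **Thm. B ⟹ A♮ ⟹ A (PROVED composition), A BY NAME.** -/
theorem sigmaCongruenceAtThree_of_canonicalRoot
    (hB : Literature.NumberTheory.EllipticCurves.Hsieh2014.thmB_exists_isHsiehLFunction_coeff_norm_eq_one_unrPeriod_anyLevel)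
    (h : CanonicalRootCongruenceAtThree) : SigmaCongruenceAtThree :=
  sigmaCongruenceAtThree_of_congruentSquareRootPair hB (congruentSquareRootPair_of_canonicalRoot h)

/-! ### §3 KI♭ `IntegralRootFunctionalAtThree` (g18 KI♯ WITHOUT the valuation clause), KI♭ ∧ H ⟹ A♮ ⟹ A -/

/-- **KI♭ `IntegralRootFunctionalAtThree`** — the Hsieh–Katz INTEGRAL CM FUNCTIONAL, values-only shadow on the two
`3`-depleted coefficient vectors `g_E(n) = 𝟙_{(n,3NN′)=1}·a_n(E)`, `g_{E′}` (binders = A's, verbatim):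
ONE additive `Θ : (ℕ → ℤ) →+ R₀⟦T⟧` and exponents `e_v ≠ 0` of valuation `c_v` with
(wild♭) `C a·(u·𝓛·Π_E(e)) = C b·Θ(g_E)²`, `u` a monomial unit gauge, `a, b ≠ 0` — NO CONDITION ON `‖a‖/‖b‖`
(N1: it is forced, `twin_forcing`);
(twin♭) `C a′·(u′·𝓛′·Π_{E′}(e)) = C b′·Θ(g_{E′})²` with the CANONICAL tame constant `‖a′‖ = ‖b′‖`.
Print inputs of the port (memo §3): `Θ` = Hsieh's `θ ↦ 𝒫`-construction [Hsieh2014, §3.4–§4, Thm. 3.9 /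
Prop. 4.6] = Katz measure against the Serre–Tate expansion of the depleted toric form, `ℤ`-linear and
`R₀`-integral in the `q`-expansion [Hsieh2014, Thm. 3.9 (integrality); KrizLi2019, §3 (congruences of `𝒫` from
congruences of forms)]; (wild♭)/(twin♭) frame identification = Hsieh Thm. A + BDP13 Thm. 5.13/(3.44) + the route's
`WildSplitFrameAtThreeOddOfPrint` (CLOSED) reading (E1″) `𝒫² ↔ IsBDPLFunction` frame up to period gauge
(monomial) and a constant; the tame constant is a `3`-unit [BDP13, (3.44); Hsieh2014, Thm. A `‖ι⁻¹C‖ = 1`].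
Tag: named-fact-shaped · PRESENTATION of A♮ (g18 §1: an additive `Θ` tested on two vectors is free, so KI♭'s
functional-free shadow is «(wild♮) ∧ (twin♮ with canonical constant)») · ATTACKABLE (port) · no valuation clause,
no (μ′) clause (both DERIVED: `canonicalRoot_of_integralRootFunctional`).
[cite: Hsieh2014, Thm. A, Thm. 3.9, Prop. 4.6] [cite: BDP2013, Thm. 5.13, (3.44)] [cite: KrizLi2019, §3] -/
def IntegralRootFunctionalAtThree : Prop :=
      ∀ (W : WeierstrassCurve ℚ) [W.IsElliptic] [W.IsGloballyMinimal] (W' : WeierstrassCurve ℚ) [W'.IsElliptic]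
      [W'.IsGloballyMinimal] (N N' : ℕ) [NeZero N] [NeZero N'] (K : Type) [Field K] [NumberField K] (Dt :
      Literature.NumberTheory.EllipticCurves.ModularForms.ModularParametrizationData W N) (Dt' :
      Literature.NumberTheory.EllipticCurves.ModularForms.ModularParametrizationData W' N'),
      Summit.BirchSwinnertonDyer.Rank1Residual.Additive.ClassO6 W 3 → W.HasSurjectiveModNGaloisRep 3 →
      W.analyticRank = 1 → W.conductorNorm ℤ = N → Summit.BirchSwinnertonDyer.Rank1Residual.O6.ModPCongruent W' W
      3 → ¬ Literature.NumberTheory.EllipticCurves.Rank1Residual.Addv W' 3 → W'.conductorNorm ℤ = N' →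
      Literature.NumberTheory.EllipticCurves.IsImaginaryQuadratic K →
      Literature.NumberTheory.EllipticCurves.SatisfiesHeegnerHypothesis N K →
      Literature.NumberTheory.EllipticCurves.SatisfiesHeegnerHypothesis N' K → ∀ (κ :
      Literature.NumberTheory.EllipticCurves.ZpExtension K 3), κ.IsAnticyclotomic → ∀ (γ :
      Field.absoluteGaloisGroup K) [Fact (κ.IsTopGenerator γ)] (𝔭 : IsDedekindDomain.HeightOneSpectrum
      (NumberField.RingOfIntegers K)), ((3 : ℕ) : NumberField.RingOfIntegers K) ∈ 𝔭.asIdeal →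
      𝔭.asIdeal.ramificationIdx (NumberField.RingOfIntegers ℚ) = 1 → 𝔭.asIdeal.inertiaDeg
      (NumberField.RingOfIntegers ℚ) = 1 → ∀ (𝔭' : IsDedekindDomain.HeightOneSpectrum (NumberField.RingOfIntegers
      K)), ((3 : ℕ) : NumberField.RingOfIntegers K) ∈ 𝔭'.asIdeal → 𝔭' ≠ 𝔭 → ∀ (ι' : PadicAlgCl 3 ≃+* ℂ),
      Summit.BirchSwinnertonDyer.BirchSwinnertonDyer.Theorems.SchneiderFree.BranchInducesPrime 3 ι' 𝔭 → ∀ (ΩK : ℂ)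
      (Ωp : ℂ_[3]) (L : Literature.NumberTheory.EllipticCurves.UnrSeries 3), ΩK ≠ 0 → Ωp ≠ 0 →
      Literature.NumberTheory.EllipticCurves.IsBDPLFunction ι' 𝔭 κ γ Dt.f ΩK Ωp L → ∀ (ΩK' : ℂ) (Ωp' : ℂ_[3]) (L'
      : Literature.NumberTheory.EllipticCurves.UnrSeries 3), ΩK' ≠ 0 → Ωp' ≠ 0 →
      Literature.NumberTheory.EllipticCurves.IsBDPLFunction ι' 𝔭 κ γ Dt'.f ΩK' Ωp' L' → (∃ i : ℕ,
      ‖((PowerSeries.coeff i L' : Literature.NumberTheory.EllipticCurves.unrIntegers 3) : ℂ_[3])‖ = 1) → ∀ (T :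
      Finset (IsDedekindDomain.HeightOneSpectrum (NumberField.RingOfIntegers K))) (c :
      IsDedekindDomain.HeightOneSpectrum (NumberField.RingOfIntegers K) → ℕ), (↑T = {v :
      IsDedekindDomain.HeightOneSpectrum (NumberField.RingOfIntegers K) | ((3 : ℕ) : NumberField.RingOfIntegers K)
      ∉ v.asIdeal ∧ (¬ (W.baseChange K).HasGoodReductionAt v ∨ ¬ (W'.baseChange K).HasGoodReductionAt v)}) → (∀ v
      ∈ T, (∃ d₀ : Literature.NumberTheory.EllipticCurves.GreenbergSelmer.decomp (K := K) v, (κ (d₀ :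
      Field.absoluteGaloisGroup K)).toAdd = (3 : ℤ_[3]) ^ c v) ∧ (∀ d :
      Literature.NumberTheory.EllipticCurves.GreenbergSelmer.decomp (K := K) v, (3 : ℤ_[3]) ^ c v ∣ (κ (d :
      Field.absoluteGaloisGroup K)).toAdd)) →
      ∃ (Θ : (ℕ → ℤ) →+ Literature.NumberTheory.EllipticCurves.UnrSeries 3)
        (e : IsDedekindDomain.HeightOneSpectrum (NumberField.RingOfIntegers K) → ℤ_[3]),
        (∀ v ∈ T, e v ≠ 0 ∧ (e v).valuation = c v) ∧
        (∃ (a b : Literature.NumberTheory.EllipticCurves.unrIntegers 3)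
            (u : Literature.NumberTheory.EllipticCurves.UnrSeries 3), a ≠ 0 ∧ b ≠ 0 ∧ IsUnit u ∧
          IsMonomialUnit u ∧
          PowerSeries.C a * (u * (L * PowerSeries.map (Summit.BirchSwinnertonDyer.Rank1Residual.X11b.Halves.toUnr 3)
            (∏ v ∈ T, (Polynomial.aeval
              (PowerSeries.C ((Nat.card (IsLocalRing.ResidueField (v.adicCompletionIntegers K)) : ℤ_[3]).inv) *
                PowerSeries.binomialSeries ℤ_[3] (e v)) ((W.baseChange K).localPolynomialAt v) :
              Literature.NumberTheory.EllipticCurves.IwasawaAlgebra 3)))) =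
          PowerSeries.C b * (Θ (fun n : ℕ ↦ if Nat.Coprime n (3 * (N * N')) then W.LFunction n else 0)) ^ 2) ∧
        (∃ (a' b' : Literature.NumberTheory.EllipticCurves.unrIntegers 3)
            (u' : Literature.NumberTheory.EllipticCurves.UnrSeries 3), a' ≠ 0 ∧ b' ≠ 0 ∧
          ‖((a' : Literature.NumberTheory.EllipticCurves.unrIntegers 3) : ℂ_[3])‖ =
            ‖((b' : Literature.NumberTheory.EllipticCurves.unrIntegers 3) : ℂ_[3])‖ ∧ IsUnit u' ∧
          IsMonomialUnit u' ∧
          PowerSeries.C a' * (u' * (L' * PowerSeries.map (Summit.BirchSwinnertonDyer.Rank1Residual.X11b.Halves.toUnr 3)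
            (∏ v ∈ T, (Polynomial.aeval
              (PowerSeries.C ((Nat.card (IsLocalRing.ResidueField (v.adicCompletionIntegers K)) : ℤ_[3]).inv) *
                PowerSeries.binomialSeries ℤ_[3] (e v)) ((W'.baseChange K).localPolynomialAt v) :
              Literature.NumberTheory.EllipticCurves.IwasawaAlgebra 3)))) =
          PowerSeries.C b' * (Θ (fun n : ℕ ↦ if Nat.Coprime n (3 * (N * N')) then W'.LFunction n else 0)) ^ 2)

/-- **KI♭ ∧ H ⟹ A♮ (PROVED).**  Roots `Y := Θ g_E`, `Y′ := Θ g_{E′}`; H makes `3 ∣ g_E − g_{E′}` coordinatewise, so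
`Y − Y′ = 3·Θ(x)` (additivity, `forall_exists_of_addMonoidHom`); (μ′) is DERIVED from the canonical twin constant:
`𝓛′` has a profile (A's (μ′) on `𝓛′`), `Π_{E′}(e)` has one (`order_map_toZMod_prod_aeval_localPolynomialAt`), so
`exists_coeff_norm_eq_one_of_frame` gives `μ(Y′) = 0`. [folklore] -/
theorem canonicalRoot_of_integralRootFunctional (hKI : IntegralRootFunctionalAtThree)
    (hHecke : HeckeCongruenceDepleted) : CanonicalRootCongruenceAtThree := by
  haveI : Fact (Nat.Prime 3) := ⟨Nat.prime_three⟩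
  intro W _ _ W' _ _ N N' _ _ K _ _ Dt Dt' hO6 hsurj hrk hN hmod haddv hN' hK hH hH' κ hκ γ _ 𝔭 h𝔭 hram
      hdeg 𝔭' h𝔭' hne ι' hι ΩK Ωp L hΩK hΩp hL ΩK' Ωp' L' hΩK' hΩp' hL' hi' T c hT hc
  obtain ⟨Θ, e, he, ⟨a, b, u, ha, hb, hu, hmu, hEq⟩, ⟨a', b', u', ha', hb', hab', hu', hmu', hEq'⟩⟩ :=
    hKI W W' N N' K Dt Dt' hO6 hsurj hrk hN hmod haddv hN' hK hH hH' κ hκ γ 𝔭 h𝔭 hram hdeg 𝔭' h𝔭' hne ι' hι ΩK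
      Ωp L hΩK hΩp hL ΩK' Ωp' L' hΩK' hΩp' hL' hi' T c hT hc
  have hk1 : ∀ n : ℕ, (3 : ℤ) ^ 1 ∣
      ((if Nat.Coprime n (3 * (N * N')) then W.LFunction n else 0) -
        (if Nat.Coprime n (3 * (N * N')) then W'.LFunction n else 0)) := by
    intro n
    by_cases hn : Nat.Coprime n (3 * (N * N'))
    · rw [if_pos hn, if_pos hn, pow_one]
      exact hHecke W W' N N' hN hN' hmod n hn
    · rw [if_neg hn, if_neg hn, sub_self]
      exact dvd_zero _
  obtain ⟨Z, hZ⟩ := forall_exists_of_addMonoidHom Θ _ _ 1 hk1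
  have hT3 := UniversalToricDescentSigmaCongruenceInvariantPair.not_mem_of_coe_eq hT
  obtain ⟨-, hordE'⟩ := order_map_toZMod_prod_aeval_localPolynomialAt (W'.baseChange K) T hT3 e
    (fun v hv ↦ (he v hv).1)
  obtain ⟨m', hm'⟩ := UniversalToricDescentSelfMuZero.exists_normProfile_of_exists_coeff_norm_eq_one hi'
  have hX' := normProfile_mul hm' (normProfile_map_toUnr_of_order_eq _ hordE')
  have hμ' := exists_coeff_norm_eq_one_of_frame ha' hab' hu' hX' hEq'
  refine ⟨e, _, _, he, ⟨a, b, u, ha, hb, hu, hmu, hEq⟩, ⟨a', b', u', ha', hb', hu', hmu', hEq'⟩, hμ', Z, ?_⟩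
  rw [hZ, pow_one]

/-- **N1 on A's data (PROVED): in KI♭ the wild constant is automatically canonical and `μ(Θ g_E) = 0`** — the clause
g18's KI♯ asked for («valuation of the wild constant is `g`-independent») is a CONSEQUENCE of KI♭ ∧ H ∧ Thm. B
(`twin_forcing` with `μ(𝓛) = 0` from Thm. B via `self_forall_isBDPLFunction_coeff_norm_eq_one`). -/
theorem wildConstant_canonical_of_integralRootFunctional
    (hB : Literature.NumberTheory.EllipticCurves.Hsieh2014.thmB_exists_isHsiehLFunction_coeff_norm_eq_one_unrPeriod_anyLevel)
    (hKI : IntegralRootFunctionalAtThree) (hHecke : HeckeCongruenceDepleted) :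
      ∀ (W : WeierstrassCurve ℚ) [W.IsElliptic] [W.IsGloballyMinimal] (W' : WeierstrassCurve ℚ) [W'.IsElliptic]
      [W'.IsGloballyMinimal] (N N' : ℕ) [NeZero N] [NeZero N'] (K : Type) [Field K] [NumberField K] (Dt :
      Literature.NumberTheory.EllipticCurves.ModularForms.ModularParametrizationData W N) (Dt' :
      Literature.NumberTheory.EllipticCurves.ModularForms.ModularParametrizationData W' N'),
      Summit.BirchSwinnertonDyer.Rank1Residual.Additive.ClassO6 W 3 → W.HasSurjectiveModNGaloisRep 3 →
      W.analyticRank = 1 → W.conductorNorm ℤ = N → Summit.BirchSwinnertonDyer.Rank1Residual.O6.ModPCongruent W' W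
      3 → ¬ Literature.NumberTheory.EllipticCurves.Rank1Residual.Addv W' 3 → W'.conductorNorm ℤ = N' →
      Literature.NumberTheory.EllipticCurves.IsImaginaryQuadratic K →
      Literature.NumberTheory.EllipticCurves.SatisfiesHeegnerHypothesis N K →
      Literature.NumberTheory.EllipticCurves.SatisfiesHeegnerHypothesis N' K → ∀ (κ :
      Literature.NumberTheory.EllipticCurves.ZpExtension K 3), κ.IsAnticyclotomic → ∀ (γ :
      Field.absoluteGaloisGroup K) [Fact (κ.IsTopGenerator γ)] (𝔭 : IsDedekindDomain.HeightOneSpectrum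
      (NumberField.RingOfIntegers K)), ((3 : ℕ) : NumberField.RingOfIntegers K) ∈ 𝔭.asIdeal →
      𝔭.asIdeal.ramificationIdx (NumberField.RingOfIntegers ℚ) = 1 → 𝔭.asIdeal.inertiaDeg
      (NumberField.RingOfIntegers ℚ) = 1 → ∀ (𝔭' : IsDedekindDomain.HeightOneSpectrum (NumberField.RingOfIntegers
      K)), ((3 : ℕ) : NumberField.RingOfIntegers K) ∈ 𝔭'.asIdeal → 𝔭' ≠ 𝔭 → ∀ (ι' : PadicAlgCl 3 ≃+* ℂ),
      Summit.BirchSwinnertonDyer.BirchSwinnertonDyer.Theorems.SchneiderFree.BranchInducesPrime 3 ι' 𝔭 → ∀ (ΩK : ℂ)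
      (Ωp : ℂ_[3]) (L : Literature.NumberTheory.EllipticCurves.UnrSeries 3), ΩK ≠ 0 → Ωp ≠ 0 →
      Literature.NumberTheory.EllipticCurves.IsBDPLFunction ι' 𝔭 κ γ Dt.f ΩK Ωp L → ∀ (ΩK' : ℂ) (Ωp' : ℂ_[3]) (L'
      : Literature.NumberTheory.EllipticCurves.UnrSeries 3), ΩK' ≠ 0 → Ωp' ≠ 0 →
      Literature.NumberTheory.EllipticCurves.IsBDPLFunction ι' 𝔭 κ γ Dt'.f ΩK' Ωp' L' → (∃ i : ℕ,
      ‖((PowerSeries.coeff i L' : Literature.NumberTheory.EllipticCurves.unrIntegers 3) : ℂ_[3])‖ = 1) → ∀ (T :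
      Finset (IsDedekindDomain.HeightOneSpectrum (NumberField.RingOfIntegers K))) (c :
      IsDedekindDomain.HeightOneSpectrum (NumberField.RingOfIntegers K) → ℕ), (↑T = {v :
      IsDedekindDomain.HeightOneSpectrum (NumberField.RingOfIntegers K) | ((3 : ℕ) : NumberField.RingOfIntegers K)
      ∉ v.asIdeal ∧ (¬ (W.baseChange K).HasGoodReductionAt v ∨ ¬ (W'.baseChange K).HasGoodReductionAt v)}) → (∀ v
      ∈ T, (∃ d₀ : Literature.NumberTheory.EllipticCurves.GreenbergSelmer.decomp (K := K) v, (κ (d₀ :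
      Field.absoluteGaloisGroup K)).toAdd = (3 : ℤ_[3]) ^ c v) ∧ (∀ d :
      Literature.NumberTheory.EllipticCurves.GreenbergSelmer.decomp (K := K) v, (3 : ℤ_[3]) ^ c v ∣ (κ (d :
      Field.absoluteGaloisGroup K)).toAdd)) →
      ∃ (Θ : (ℕ → ℤ) →+ Literature.NumberTheory.EllipticCurves.UnrSeries 3)
        (e : IsDedekindDomain.HeightOneSpectrum (NumberField.RingOfIntegers K) → ℤ_[3]),
        (∀ v ∈ T, e v ≠ 0 ∧ (e v).valuation = c v) ∧
        (∃ (a b : Literature.NumberTheory.EllipticCurves.unrIntegers 3)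
            (u : Literature.NumberTheory.EllipticCurves.UnrSeries 3), a ≠ 0 ∧ b ≠ 0 ∧
          ‖((a : Literature.NumberTheory.EllipticCurves.unrIntegers 3) : ℂ_[3])‖ =
            ‖((b : Literature.NumberTheory.EllipticCurves.unrIntegers 3) : ℂ_[3])‖ ∧ IsUnit u ∧
          IsMonomialUnit u ∧
          PowerSeries.C a * (u * (L * PowerSeries.map (Summit.BirchSwinnertonDyer.Rank1Residual.X11b.Halves.toUnr 3)
            (∏ v ∈ T, (Polynomial.aeval
              (PowerSeries.C ((Nat.card (IsLocalRing.ResidueField (v.adicCompletionIntegers K)) : ℤ_[3]).inv) *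
                PowerSeries.binomialSeries ℤ_[3] (e v)) ((W.baseChange K).localPolynomialAt v) :
              Literature.NumberTheory.EllipticCurves.IwasawaAlgebra 3)))) =
          PowerSeries.C b * (Θ (fun n : ℕ ↦ if Nat.Coprime n (3 * (N * N')) then W.LFunction n else 0)) ^ 2) ∧
        (∃ i : ℕ, ‖((PowerSeries.coeff i (Θ (fun n : ℕ ↦ if Nat.Coprime n (3 * (N * N')) then W.LFunction n else 0)) :
          Literature.NumberTheory.EllipticCurves.unrIntegers 3) : ℂ_[3])‖ = 1) := by
  haveI : Fact (Nat.Prime 3) := ⟨Nat.prime_three⟩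
  intro W _ _ W' _ _ N N' _ _ K _ _ Dt Dt' hO6 hsurj hrk hN hmod haddv hN' hK hH hH' κ hκ γ _ 𝔭 h𝔭 hram
      hdeg 𝔭' h𝔭' hne ι' hι ΩK Ωp L hΩK hΩp hL ΩK' Ωp' L' hΩK' hΩp' hL' hi' T c hT hc
  obtain ⟨Θ, e, he, ⟨a, b, u, ha, hb, hu, hmu, hEq⟩, ⟨a', b', u', ha', hb', hab', hu', hmu', hEq'⟩⟩ :=
    hKI W W' N N' K Dt Dt' hO6 hsurj hrk hN hmod haddv hN' hK hH hH' κ hκ γ 𝔭 h𝔭 hram hdeg 𝔭' h𝔭' hne ι' hι ΩK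
      Ωp L hΩK hΩp hL ΩK' Ωp' L' hΩK' hΩp' hL' hi' T c hT hc
  have hk1 : ∀ n : ℕ, (3 : ℤ) ^ 1 ∣
      ((if Nat.Coprime n (3 * (N * N')) then W.LFunction n else 0) -
        (if Nat.Coprime n (3 * (N * N')) then W'.LFunction n else 0)) := by
    intro n
    by_cases hn : Nat.Coprime n (3 * (N * N'))
    · rw [if_pos hn, if_pos hn, pow_one]
      exact hHecke W W' N N' hN hN' hmod n hn
    · rw [if_neg hn, if_neg hn, sub_self]
      exact dvd_zero _
  obtain ⟨Z, hZ⟩ := forall_exists_of_addMonoidHom Θ _ _ 1 hk1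
  have hcongr : ∀ i : ℕ, ‖((PowerSeries.coeff i
      (Θ (fun n : ℕ ↦ if Nat.Coprime n (3 * (N * N')) then W.LFunction n else 0) -
        Θ (fun n : ℕ ↦ if Nat.Coprime n (3 * (N * N')) then W'.LFunction n else 0)) :
      Literature.NumberTheory.EllipticCurves.unrIntegers 3) : ℂ_[3])‖ < 1 := by
    intro i
    rw [hZ, pow_one, three_eq_C, PowerSeries.coeff_C_mul]
    exact norm_three_mul_lt_one _
  have hT3 := UniversalToricDescentSigmaCongruenceInvariantPair.not_mem_of_coe_eq hT
  obtain ⟨-, hordE⟩ := order_map_toZMod_prod_aeval_localPolynomialAt (W.baseChange K) T hT3 e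
    (fun v hv ↦ (he v hv).1)
  obtain ⟨-, hordE'⟩ := order_map_toZMod_prod_aeval_localPolynomialAt (W'.baseChange K) T hT3 e
    (fun v hv ↦ (he v hv).1)
  obtain ⟨m, hm⟩ := UniversalToricDescentSelfMuZero.exists_normProfile_of_exists_coeff_norm_eq_one
    (UniversalToricDescentSelfMuZero.self_forall_isBDPLFunction_coeff_norm_eq_one hB W N K Dt hO6 hsurj hrk hN hK
      hH κ hκ γ 𝔭 h𝔭 hram hdeg 𝔭' h𝔭' hne ι' hι ΩK Ωp L hΩK hΩp hL)
  obtain ⟨m', hm'⟩ := UniversalToricDescentSelfMuZero.exists_normProfile_of_exists_coeff_norm_eq_one hi'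
  have hX := normProfile_mul hm (normProfile_map_toUnr_of_order_eq _ hordE)
  have hX' := normProfile_mul hm' (normProfile_map_toUnr_of_order_eq _ hordE')
  obtain ⟨hab, hμ⟩ := twin_forcing ha hb ha' hab' hu hu' hX hX' hEq hEq' hcongr
  exact ⟨Θ, e, he, ⟨a, b, u, ha, hb, hab, hu, hmu, hEq⟩, hμ⟩

/-- **Thm. B ⟹ H ⟹ KI♭ ⟹ A (PROVED composition), A BY NAME** — the port target of the line re-typed: Hecke
congruence (M) + the integral CM functional with canonical TAME constant (port) + Hsieh Thm. B (print). -/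
theorem sigmaCongruenceAtThree_of_integralRootFunctional
    (hB : Literature.NumberTheory.EllipticCurves.Hsieh2014.thmB_exists_isHsiehLFunction_coeff_norm_eq_one_unrPeriod_anyLevel)
    (hHecke : HeckeCongruenceDepleted) (hKI : IntegralRootFunctionalAtThree) : SigmaCongruenceAtThree :=
  sigmaCongruenceAtThree_of_canonicalRoot hB (canonicalRoot_of_integralRootFunctional hKI hHecke)

end Summit.BirchSwinnertonDyer.BirchSwinnertonDyer.Cruxes.SigmaCongruenceAtThree.TwinForcedConstant

/-! ### §4 N2 — Hsieh prints the ROOT: the one-clause sharpening of the any-level Hsieh fact (typer target) -/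

namespace Summit.BirchSwinnertonDyer.BirchSwinnertonDyer.Cruxes.SigmaCongruenceAtThree.TwinForcedConstant

open scoped MatrixGroups ModularForm NumberField
open CongruenceSubgroup NumberField IsDedekindDomain Field
open Literature.NumberTheory.GaloisRepresentations Literature.NumberTheory.EllipticCurves.ModularForms
  Literature.NumberTheory.Automorphic Literature.NumberTheory.EllipticCurves

/-- **`HsiehRootFormAnyLevel`** — `Hsieh2014.thmA_exists_isHsiehLFunction_unrPeriod_anyLevel` with its conclusion
sharpened by ONE clause: the interpolating series is a SQUARE, `Q = P²`.  Print: [Hsieh2014, Thm. A p. 712 =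
arXiv:1112.1580 Thm. 1 pp. 3–4] constructs `𝒫_Σ(π,λ) ∈ Λ` with `𝒫² ` interpolating the toric periods, and
`ℒ_p(π_K ⊗ χ) = [g]⁻¹·Tw_{λ̂⁻¹}(𝒫_Σ(π,λ)²)` ((W2) of `AnticyclotomicRankinSelbergPAdicLFunction.lean`); `Γ⁻ ≅ ℤ_p`
is pro-`p`, `p` odd, so `g = h²` in `Γ⁻` and `[g]⁻¹·Tw(𝒫²) = ([h]⁻¹·Tw 𝒫)²` (`Tw` a ring automorphism of
`𝒪⟦Γ⁻⟧`).  Hence this statement is WEAKER than print and implies the tree's fact (`thmA_anyLevel_of_rootForm`).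
Use on the crux: it types g18's leaf Sq_E («the wild frame is const·unit·SQUARE in `R₀⟦T⟧`») up to the
`R₀`-descent of the root (memo §2: a square root in `𝒪_{ℂ₃}⟦T⟧` of a `μ = 0` element of `R₀⟦T⟧` lies in
`±R₀⟦T⟧`, Weierstrass preparation + `k_{R₀} = 𝔽̄₃`).  Tag: named-fact-shaped · typer target (S) · nothing asserted.
[cite: Hsieh2014, Thm. A p. 712, Prop. 3.5, §3.6.2, Lemma 5.4 (2)] -/
def HsiehRootFormAnyLevel : Prop :=
  ∀ {p : ℕ} [Fact p.Prime] (ι : PadicAlgCl p ≃+* ℂ) (K : Type) [Field K] [NumberField K]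
    (𝔭 : HeightOneSpectrum (𝓞 K)) (κ : ZpExtension K p) (γ : absoluteGaloisGroup K)
    {N : ℕ} [NeZero N] (f : CuspForm (Gamma0 N) 2) (lam : HeckeCharacter K)
    (rlam : FramedGaloisRep K (PadicAlgCl p) 1),
    p ≠ 2 → IsNewform0 f →
    IsImaginaryQuadratic K → ((Ideal.span {(p : ℤ)}).primesOver (𝓞 K)).ncard = 2 →
    ((p : ℕ) : 𝓞 K) ∈ 𝔭.asIdeal →
    (∀ (w : InfinitePlace K) (k : 𝓞 K), k ∈ 𝔭.asIdeal ↔ ‖ι.symm (w.embedding (k : K))‖ < 1) →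
    SatisfiesHeegnerHypothesis N K →
    lam.IsUnitary → lam.HasInfinityType (fun _ ↦ (1 : ℤ)) (fun _ ↦ (-1 : ℤ)) →
    (∀ x : ideleGroup ℚ, lam (AdeleRing.ideleBaseChange ℚ K x) = 1) →
    (∀ v : HeightOneSpectrum (𝓞 K), ((p : ℕ) : 𝓞 K) ∉ v.asIdeal → lam.IsUnramifiedAt v) →
    IsPAdicAvatarOf ι lam rlam → FactorsThroughZp κ rlam →
    κ.IsAnticyclotomic → κ.IsTopGenerator γ →
    ∃ (A : ℝ) (ΩK C : ℂ) (Ωp : (unrIntegers p)ˣ) (P : PowerSeries (PadicComplexInt p)),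
      0 < A ∧ ΩK ≠ 0 ∧ ‖((ι.symm C : PadicAlgCl p) : ℂ_[p])‖ = 1 ∧
        IsHsiehLFunction ι 𝔭 κ γ f A ΩK C ((Ωp : unrIntegers p) : ℂ_[p]) (P ^ 2)

/-- **`HsiehRootFormAnyLevel` ⟹ the tree's any-level Hsieh fact (PROVED; `Q := P²`).** -/
theorem thmA_anyLevel_of_rootForm (h : HsiehRootFormAnyLevel) :
    Literature.NumberTheory.EllipticCurves.Hsieh2014.thmA_exists_isHsiehLFunction_unrPeriod_anyLevel := by
  intro p _ ι K _ _ 𝔭 κ γ N _ f lam rlam hp hnew hK hsplit h𝔭 hι hHeeg hunit hinf htriv hunr hav hfac hκ hγ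
  obtain ⟨A, ΩK, C, Ωp, P, hA, hΩK, hC, hP⟩ :=
    h ι K 𝔭 κ γ f lam rlam hp hnew hK hsplit h𝔭 hι hHeeg hunit hinf htriv hunr hav hfac hκ hγ
  exact ⟨A, ΩK, C, Ωp, P ^ 2, hA, hΩK, hC, hP⟩

end Summit.BirchSwinnertonDyer.BirchSwinnertonDyer.Cruxes.SigmaCongruenceAtThree.TwinForcedConstant

end
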